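import Summits.ValiantsHypothesis.ValiantsHypothesis.Theorems.LacunarySymmetroidMatrixDescartesPivotRankOneCriticalWindowsTurningParity
import Summits.ValiantsHypothesis.ValiantsHypothesis.Theorems.LacunarySymmetroidMatrixDescartesPivotRankOneCriticalWindowsTurningEndsMirror

/-!
# `MatrixDescartes` census — rank-one `(2,4)₁`: THE TURNING-POINT COUNT WITH PARITY ON THE `3|1` SPLIT (mirror of `…TurningParity`)
# (`#turning points of E` even ⇒ `Z₊(det F) ≤ #turning points + 1` when THREE letters lie below the pivot)

HONEST FRAMING.  Object-search cell `pub-symmetroid`, seat `val-sym-mdr-p1` (generation 27); helper file `--supports` the crux item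
stmt-ValiantsHypothesis-18050 (`Theses.LacunarySymmetroid.MatrixDescartes`, OPEN, on HOLD) with NO closure claim.  `…TurningParity` proved the
parity-sharpened turning count on the `1|3` split (chamber (C) side); this file is its mirror for the `3|1` split (chamber (C′) side):
§1 `card_levelSet_le_card_of_lt_ends` — the Rolle count with parity for a function lying strictly BELOW the level near `0⁺` and near `∞`
(from the `gt` version applied to `−ψ`); §2 ★ `rankOne_threeOne_card_posRoots_le_turning_add_one`: on the `3|1` split (`d₀ < d₁ ≤ d₂ < e < d₃`,
all-core rank-one letters, `0∦1`, `2∦3`), if `T ⊇` the positive zeros of `E′` has EVEN cardinality then `Z₊(det F) ≤ #T + 1`, with the end values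
`E < e` of `…TurningEndsMirror`; census currency `rankOne_threeOne_pivotPosRoots_le_turning_add_one`.  Together with `…TurningParity`: under the
located turning number `6` BOTH odd chambers (C), (C′) of the rank-one `(2,4)₁` cell would read `≤ 7` = SEVEN; the turning bound is NOT claimed.
Nothing here bears on `MatrixDescartes` in its window, on `DoorA26` / `DoorA34`, registers / credences, or `VP ≠ VNP`.

[folklore] `HasDerivAt.neg`; tree `…TurningParity.card_levelSet_le_card_of_gt_ends`, `…Turning.*`, `…TurningEndsMirror.*`, `…RootCount.*`,
`…Resolvent.card_posRoots_le_card_add_one`.  No definitions, no named facts.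
-/

-- `Summit.ValiantsHypothesis.ValiantsHypothesis.…` repeats a component by the D-0017 layout
-- (single-conjunct summit), which the `dupNamespace` linter flags; the name is mandated.
set_option linter.dupNamespace false

namespace Summit.ValiantsHypothesis.ValiantsHypothesis.Theorems.LacunarySymmetroidMatrixDescartes.Pivot.CriticalWindows.TurningParityMirror

open Finset Set
open scoped BigOperators Topology
open Summit.ValiantsHypothesis.ValiantsHypothesis.Theorems.LacunarySymmetroidMatrixDescartes.Pivot.CriticalWindows.Turning
  (card_levelSet_le_card_add_one optDir_pos_sq dent_pos differentiableAt_profile critical_iff_profile_eq)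
open Summit.ValiantsHypothesis.ValiantsHypothesis.Theorems.LacunarySymmetroidMatrixDescartes.Pivot.CriticalWindows.TurningParity
  (card_levelSet_le_card_of_gt_ends)
open Summit.ValiantsHypothesis.ValiantsHypothesis.Theorems.LacunarySymmetroidMatrixDescartes.Pivot.CriticalWindows.TurningEndsMirror
  (profile_lt_near_zero profile_lt_near_infty)
open Summit.ValiantsHypothesis.ValiantsHypothesis.Theorems.LacunarySymmetroidMatrixDescartes.Pivot.Resolvent
  (card_posRoots_le_card_add_one)
open Summit.ValiantsHypothesis.ValiantsHypothesis.Theorems.LacunarySymmetroidMatrixDescartes.Pivot.CriticalWindows.RootCount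
  (moments_pos gapProfile_eq_zero_iff hasDerivAt_gapProfile det_rankOne_hyperbolic_eval)
open Summit.ValiantsHypothesis.ValiantsHypothesis.Theorems.LacunarySymmetroidMatrixDescartes.Pivot (pivotPosRoots)

/-! ## 1. The Rolle count with parity, ends below the level -/

/-- **ROLLE COUNT WITH PARITY (ends below).**  As `…TurningParity.card_levelSet_le_card_of_gt_ends` with `ψ < c` near `0⁺` and near `∞`:
if `#T` is even then the full positive level set has `#S ≤ #T`. [folklore] -/
theorem card_levelSet_le_card_of_lt_ends (ψ ψ' : ℝ → ℝ) (c : ℝ) (hder : ∀ x, 0 < x → HasDerivAt ψ (ψ' x) x)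
    (S : Finset ℝ) (hS : ∀ x ∈ S, 0 < x ∧ ψ x = c) (hfull : ∀ x, 0 < x → ψ x = c → x ∈ S)
    (T : Finset ℝ) (hT : ∀ y, 0 < y → ψ' y = 0 → y ∈ T) (hTeven : Even T.card)
    (h0 : ∃ a, 0 < a ∧ ∀ x, 0 < x → x ≤ a → ψ x < c) (h1 : ∃ b, 0 < b ∧ ∀ x, b ≤ x → ψ x < c) :
    S.card ≤ T.card := by
  obtain ⟨a, ha, h0a⟩ := h0
  obtain ⟨b, hb, h1b⟩ := h1
  refine card_levelSet_le_card_of_gt_ends (fun x => -ψ x) (fun x => -ψ' x) (-c) (fun x hx => (hder x hx).neg) S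
    (fun x hx => ⟨(hS x hx).1, by rw [(hS x hx).2]⟩) (fun x hx hxc => hfull x hx (by linarith)) T
    (fun y hy h0 => hT y hy (by linarith)) hTeven ⟨a, ha, fun x hx hxa => by linarith [h0a x hx hxa]⟩
    ⟨b, hb, fun x hbx => by linarith [h1b x hbx]⟩

/-! ## 2. The `3|1` row: turning points with parity -/

/-- **★ THE TURNING-POINT COUNT WITH PARITY ON THE `3|1` SPLIT.**  Rank-one hyperbolic pencil data on four letters: positive weights and
positions, letters `0, 1` and `2, 3` non-parallel, exponents `d₀ < d₁ ≤ d₂ < e < d₃` (THREE letters below the pivot); `f` any real polynomial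
whose positive roots are the positive zeros of `A C − (U + x^e)²`.  If `T ⊇` the positive zeros of `E′` has even cardinality then
`Z₊(f) ≤ #T + 1`. [this file] -/
theorem rankOne_threeOne_card_posRoots_le_turning_add_one (w t : Fin 4 → ℝ) (d : Fin 4 → ℕ) (e : ℕ)
    (hw : ∀ k, 0 < w k) (ht : ∀ k, 0 < t k) (h01 : t 0 ≠ t 1) (h23 : t 2 ≠ t 3)
    (h01d : d 0 < d 1) (h12 : d 1 ≤ d 2) (h2e : d 2 < e) (he3 : e < d 3) (f : Polynomial ℝ)
    (hf : ∀ x, 0 < x → (f.IsRoot x ↔ (∑ k, w k * x ^ d k) * (∑ k, w k * t k ^ 2 * x ^ d k)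
      - ((∑ k, w k * t k * x ^ d k) + x ^ e) ^ 2 = 0))
    (T : Finset ℝ) (hT : ∀ y, 0 < y → deriv (fun z =>
      (∑ k, (d k : ℝ) * (w k * z ^ d k)
          * (Real.sqrt ((∑ l, w l * t l ^ 2 * z ^ d l) / (∑ l, w l * z ^ d l)) - t k) ^ 2)
        / (∑ k, w k * z ^ d k
          * (Real.sqrt ((∑ l, w l * t l ^ 2 * z ^ d l) / (∑ l, w l * z ^ d l)) - t k) ^ 2)) y = 0 → y ∈ T)
    (hTeven : Even T.card) :
    (f.roots.toFinset.filter (fun r => 0 < r)).card ≤ T.card + 1 := by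
  classical
  have hs : (Finset.univ : Finset (Fin 4)).Nonempty := ⟨0, Finset.mem_univ _⟩
  have hw' : ∀ m ∈ (Finset.univ : Finset (Fin 4)), 0 < w m := fun m _ => hw m
  have ht' : ∀ m ∈ (Finset.univ : Finset (Fin 4)), 0 < t m := fun m _ => ht m
  have hi : (0 : Fin 4) ∈ (Finset.univ : Finset (Fin 4)) := Finset.mem_univ _
  have hj : (1 : Fin 4) ∈ (Finset.univ : Finset (Fin 4)) := Finset.mem_univ _
  set τ : ℝ → ℝ := fun x => Real.sqrt ((∑ k, w k * t k ^ 2 * x ^ d k) / (∑ k, w k * x ^ d k)) with hτdef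
  have hτ : ∀ x, 0 < x → 0 < τ x ∧ (∑ k, w k * x ^ d k) * τ x ^ 2 = ∑ k, w k * t k ^ 2 * x ^ d k :=
    fun x hx => optDir_pos_sq Finset.univ hs w t d hw' ht' hx
  set φ : ℝ → ℝ := fun y => (Real.sqrt ((∑ k, w k * y ^ d k) * (∑ k, w k * t k ^ 2 * y ^ d k))
      - ∑ k, w k * t k * y ^ d k) / y ^ e - 1 with hφdef
  set φ' : ℝ → ℝ := fun x => (∑ k, ((d k : ℝ) - e) * (w k * x ^ d k) * (τ x - t k) ^ 2) / (2 * τ x * x ^ (e + 1))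
    with hφ'def
  have hφ : ∀ x, 0 < x → (φ x = 0 ↔ f.IsRoot x) := by
    intro x hx
    obtain ⟨hA, hU, hC⟩ := moments_pos Finset.univ hs w t d hw' ht' hx
    rw [hf x hx, hφdef]
    exact gapProfile_eq_zero_iff _ _ _ _ (mul_pos hA hC).le (add_pos hU (pow_pos hx e)).le (pow_pos hx e)
  have hder : ∀ x, 0 < x → HasDerivAt φ (φ' x) x := fun x hx =>
    hasDerivAt_gapProfile Finset.univ hs w t d e hw' ht' hx (hτ x hx).1 (hτ x hx).2
  set E : ℝ → ℝ := fun z =>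
      (∑ k, (d k : ℝ) * (w k * z ^ d k)
          * (Real.sqrt ((∑ l, w l * t l ^ 2 * z ^ d l) / (∑ l, w l * z ^ d l)) - t k) ^ 2)
        / (∑ k, w k * z ^ d k
          * (Real.sqrt ((∑ l, w l * t l ^ 2 * z ^ d l) / (∑ l, w l * z ^ d l)) - t k) ^ 2) with hEdef
  have hEder : ∀ x, 0 < x → HasDerivAt E (deriv E x) x := fun x hx =>
    (differentiableAt_profile Finset.univ w t d hw' ht' hi hj h01 hx).hasDerivAt
  have hcritE : ∀ c, 0 < c → φ' c = 0 → E c = e := by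
    intro c hc h0
    have hE1 : ∑ m, w m * c ^ d m * (τ c ^ 2 - t m ^ 2) = 0 := by
      have : ∑ m, w m * c ^ d m * (τ c ^ 2 - t m ^ 2)
          = (∑ k, w k * c ^ d k) * τ c ^ 2 - ∑ k, w k * t k ^ 2 * c ^ d k := by
        rw [Finset.sum_mul, ← Finset.sum_sub_distrib]
        exact Finset.sum_congr rfl fun k _ => by ring
      rw [this, (hτ c hc).2, sub_self]
    have hE2 : ∑ m, ((d m : ℝ) - e) * (w m * c ^ d m) * (τ c - t m) ^ 2 = 0 := by
      rw [hφ'def, div_eq_zero_iff] at h0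
      rcases h0 with h0 | h0
      · exact h0
      · exact absurd h0 (mul_pos (mul_pos two_pos (hτ c hc).1) (pow_pos hc _)).ne'
    exact (critical_iff_profile_eq Finset.univ w t d e hw' ht' hi hj h01 hc).1 ⟨τ c, (hτ c hc).1, hE1, hE2⟩
  set L : Set ℝ := {x | 0 < x ∧ E x = e} with hL
  have hbudget : ∀ S : Finset ℝ, (∀ x ∈ S, 0 < x ∧ E x = e) → S.card ≤ T.card + 1 :=
    fun S hS => card_levelSet_le_card_add_one E (deriv E) (e : ℝ) hEder S hS T hT
  have hLfin : L.Finite := by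
    by_contra hinf
    obtain ⟨S, hS, hcard⟩ := Set.Infinite.exists_subset_card_eq hinf (T.card + 2)
    have := hbudget S fun x hx => hS hx
    omega
  have hLcard : hLfin.toFinset.card ≤ T.card :=
    card_levelSet_le_card_of_lt_ends E (deriv E) e hEder hLfin.toFinset (fun x hx => by simpa [hL] using hx)
      (fun x hx hxe => by simp only [Set.Finite.mem_toFinset, hL, Set.mem_setOf_eq]; exact ⟨hx, hxe⟩) T hT hTeven
      (profile_lt_near_zero w t d e hw ht h01 h01d h12 h2e.le (lt_of_le_of_lt h12 h2e) he3)
      (profile_lt_near_infty w t d e hw ht h01 h23 (h01d.le.trans h12) h12 h2e he3)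
  set crit : Set ℝ := {c | 0 < c ∧ φ' c = 0} with hcrit
  have hcritsub : crit ⊆ L := fun c hc => ⟨hc.1, hcritE c hc.1 hc.2⟩
  have hcritfin : crit.Finite := hLfin.subset hcritsub
  have hcard_crit : hcritfin.toFinset.card ≤ T.card := by
    refine le_trans (Finset.card_le_card fun c hc => ?_) hLcard
    rw [Set.Finite.mem_toFinset] at hc ⊢
    exact hcritsub hc
  have h := card_posRoots_le_card_add_one f φ φ' hφ hder hcritfin.toFinset
    (fun c hc h0 => by simpa [hcrit] using And.intro hc h0)
  omega

/-- **CENSUS CURRENCY (`3|1`).**  `pivotPosRoots e d [[0,1],[1,0]] (k ↦ wₖ·(1,tₖ)(1,tₖ)ᵀ) ≤ #T + 1` on the `3|1` split when `#T` is even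
(`T ⊇` the positive zeros of `E′`). [this file] -/
theorem rankOne_threeOne_pivotPosRoots_le_turning_add_one (w t : Fin 4 → ℝ) (d : Fin 4 → ℕ) (e : ℕ)
    (hw : ∀ k, 0 < w k) (ht : ∀ k, 0 < t k) (h01 : t 0 ≠ t 1) (h23 : t 2 ≠ t 3)
    (h01d : d 0 < d 1) (h12 : d 1 ≤ d 2) (h2e : d 2 < e) (he3 : e < d 3)
    (T : Finset ℝ) (hT : ∀ y, 0 < y → deriv (fun z =>
      (∑ k, (d k : ℝ) * (w k * z ^ d k)
          * (Real.sqrt ((∑ l, w l * t l ^ 2 * z ^ d l) / (∑ l, w l * z ^ d l)) - t k) ^ 2)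
        / (∑ k, w k * z ^ d k
          * (Real.sqrt ((∑ l, w l * t l ^ 2 * z ^ d l) / (∑ l, w l * z ^ d l)) - t k) ^ 2)) y = 0 → y ∈ T)
    (hTeven : Even T.card) :
    pivotPosRoots e d (!![(0 : ℝ), 1; 1, 0]) (fun k => w k • Matrix.vecMulVec ![1, t k] ![1, t k]) ≤ T.card + 1 := by
  unfold pivotPosRoots
  exact rankOne_threeOne_card_posRoots_le_turning_add_one w t d e hw ht h01 h23 h01d h12 h2e he3 _
    (fun x _ => by rw [Polynomial.IsRoot.def, det_rankOne_hyperbolic_eval]) T hT hTeven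

end Summit.ValiantsHypothesis.ValiantsHypothesis.Theorems.LacunarySymmetroidMatrixDescartes.Pivot.CriticalWindows.TurningParityMirror
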